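import Literature.MathematicalPhysics.QuantumFieldTheory.BalabanImbrieJaffe1984to88.BIJ88PolyInteractionLimits308
import Literature.MathematicalPhysics.QuantumFieldTheory.BalabanImbrieJaffe1984to88.BIJ88PertTerms5141

/-!
# `BalabanImbrieJaffe1984to88.BIJ88PolyInteractionAction308` — T. Bałaban, J. Imbrie, A. Jaffe, *Effective action and cluster
properties of the abelian Higgs model*, Commun. Math. Phys. **114** (1988) 257–315 [BalabanImbrieJaffe1988]: Sect. 5.14, p. 308 [PDF 52],
verbatim (renders `lit-balaban-r16/renders/cmp114/original-p052-x2.png`, `lit-balaban-ref-1/renders/cmp114/original-p053-x2.png`, both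
re-read as images by this seat): *"Define z_t(Λ₁₂^{(k)}) for t ∈ [0,1] by replacing Ṽ(Λ₁₂^{(k)}) with tṼ(Λ₁₂^{(k)}), replacing χ(cp(e_k),
(I − Q^{s*}Q)A^{(k)}) with χ(cp(te_k), (I − Q^{s*}Q)A^{(k)}), and similarly for χ(cp(e_k), φ^{(k)}). … Thus we define perturbative terms
for the action,
𝒫_{k+1}(Λ₁₂^{(k)}) = Σ_{α=1}^{n̄} −(1/α!)(dᵅ/dtᵅ) log z_t(Λ₁₂^{(k)})|_{t=0}, (5.14.1) and a remainder ℛ_k(Λ₁₂^{(k)}) = ∫₀¹ dt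
−((1−t)^{n̄}/(n̄+1)!) ⟨d/dt; …; d/dt⟩_t. (5.14.2)"* together with p. 309 *"This is obtained in the Gaussian integration estimate, using
the fact that V^{(k)}(Y) is a small polynomial in A^{(k)}, φ^{(k)}. [The restrictions disappear as t → 0, so V^{(k)}(Y) cannot be replaced
by its supremum.] The factors e^{−tV^{(k)}(Y)} − 1 can be bounded as before, because the coefficient t in front of V^{(k)}(Y) plus a small
power of e_k easily beat the bounds A^{(k)}, φ^{(k)} ≦ cp(e_k)."* (print: `V^{(k)}(Y)` WITHOUT tilde and `≦ cp(e_k)` — the v1 headers of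
`BIJ88PolyInteraction308`/`…Bounds308` misquote both spots as `Ṽ^{(k)}(Y)` / `≲ cp(te_k)` and `…Limits308` the first; referee ref-5
gen 28; docstring errata filed separately, theorems unaffected: the Lean radii are the p. 308 `c_b·p(te_k)` of `χ_{Λ,t}`) —
**(5.14.1)–(5.14.2) AS TYPED for the restricted interacting family with a POLYNOMIALLY BOUNDED interaction**
`|W| ≤ K(1 + Σ_{b∈Λ}|Φ_b|)^m` (files `BIJ88PolyInteraction308`, `BIJ88PolyInteractionBounds308`, `BIJ88PolyInteractionLimits308`; the
bounded-`W` version is `BIJ88PertTerms5141`).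

statement-level skeleton of published theorems with citation tags; proofs where landed; nothing here is a claim about the Yang–Mills mass gap

WHAT THIS FILE ADDS (theorems only; no definitions, no `Prop` facts; axioms standard).
* §1 **`t ↦ log z_t` is `Cⁿ` on the CLOSED interval `[0,1]` for every `n`** (`contDiffOn_Icc_log_polyInteraction`): the one-sided iterated
  derivatives at the Gaussian point `t = 0` exist and equal the cumulants of `−Ṽ` written through its Gaussian moments,
  `iteratedDerivWithin α (log z) [0,1] 0 = κ_α := Σ_{c : OrderedFinpartition α} log^{(|c|)}(1)·Π_j ∫ (−W)^{|c_j|} dP`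
  (`iteratedDerivWithin_log_polyInteraction_zero`; induction on `α` with Mathlib `hasDerivWithinAt_Ici_of_tendsto_deriv` fed by the
  limits of `BIJ88PolyInteractionLimits308`; `z_0 = 1` is print's convention, `BIJ88PertTerms5141.integral_restrictedInteraction_at_zero`).
* §2 **the row owner's typed leaves for polynomial `W`**: `pertP (log z) n̄ = Σ_{α<n̄} −(1/(α+1)!)·κ_{α+1}` (`pertP_polyInteraction`) and
  `taylor_logz` verbatim: `log z₁ = −pertP (log z) n̄ + ∫₀¹ ((1−t)^{n̄}/n̄!)·iteratedDerivWithin (n̄+1) (log z) [0,1] t dt`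
  (`taylor_logz_polyInteraction`); for a non-negative profile and centered jointly Gaussian fields NO standing hypothesis remains
  (`effectiveAction_polyInteraction`, `contDiffOn_Icc_log_polyInteraction'`); the (5.14.2) remainder density is continuous, hence
  integrable, on `[0,1]` (`continuousOn_remainderDensity_poly`, `integrableOn_remainderDensity_poly`); v1.1: the row owner's
  `logz_split` (print's `log z₁ = log z₀ − 𝒫̃ − ℛ` shape, T9 identification) instantiated (`logz_split_polyInteraction`).
Hypotheses: centered Gaussian marginals with variances `≤ v` (automatic under joint Gaussianity), thresholds `c_b ≥ c₀ > 0`, `p > 1/2`,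
`0 < e_k < e^{−1}`, measurable `W` with `|W| ≤ K(1 + Σ_{b∈Λ}|Φ_b|)^m`, `K ≥ 0`, and `z_t ≠ 0` on `(0,1]` (discharged by `BIJ88PolyInteraction308`).

PDF held: `paper:balaban1988-cmp114-bij-abelian-higgs-effective-action` (journal page = PDF page + 256); p. 308 [PDF 52].

CITATION HEADER (lean-in-tree rule).  Part of the lit-balaban TYPED SKELETON (HOME `run/shared/lean/pub/lit-balaban/`), Phase 2,
seat p36 (gen 8, unit `lit-balaban-p36`); row **C2.Eq5.14.1-5.14.2** of `HOME/lit-balaban-r16/ROWS-C2-part2.md` (owner r16; typed leaves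
`BIJ88Sect5StatementsPart4.pertP`/`taylor_logz` USED, not modified).
-/

namespace Literature.MathematicalPhysics.QuantumFieldTheory.BalabanImbrieJaffe1984to88.BIJ88PolyInteractionAction308

open MeasureTheory ProbabilityTheory Filter Set intervalIntegral
open scoped Nat Topology
open BIJ88Sect2Statements (pLog)
open BIJ88Sect5Statements (CutoffProfile cutoff)
open BIJ88Sect5StatementsPart4 (pertP)
open BIJ88PertTerms5141 (differentiableAt_iteratedDeriv_of_contDiffAt)

/-! ## §1 One-sided iterated derivatives at `t = 0`; `log z ∈ C^∞([0,1])` -/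

section OneSided

variable (χ : CutoffProfile) {ι Ω : Type*} [MeasurableSpace Ω]

/-- On `(0,1]` the within-`[0,1]` iterated derivatives of `log z_t` are the ordinary ones (polynomially bounded `W`; `e_k < e^{−1}`,
`z_t ≠ 0` there). [cite: BalabanImbrieJaffe1988, (5.14.1) p.308] -/
theorem iteratedDerivWithin_Icc_log_polyInteraction {p : ℝ} (hp : 0 ≤ p) (μ : Measure Ω) [IsFiniteMeasure μ] (B : Finset ι)
    {Φ : ι → Ω → ℝ} (hΦ : ∀ b ∈ B, Measurable (Φ b)) {c : ι → ℝ} (hc : ∀ b ∈ B, 0 < c b) {W : Ω → ℝ} (hW : Measurable W)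
    {K : ℝ} (hK : 0 ≤ K) {m : ℕ} (hWg : ∀ ω, |W ω| ≤ K * (1 + ∑ b ∈ B, |Φ b ω|) ^ m) {ek : ℝ} (hek : 0 < ek)
    (hek1 : ek < Real.exp (-1))
    (hz : ∀ t ∈ Set.Ioc (0 : ℝ) 1, (∫ ω, (∏ b ∈ B, cutoff χ (c b * pLog p (t * ek)) (Φ b ω)) * Real.exp (-(t * W ω)) ∂μ) ≠ 0)
    (α : ℕ) {t : ℝ} (ht : t ∈ Set.Ioc (0 : ℝ) 1) :
    iteratedDerivWithin α (fun t => Real.log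
        (∫ ω, (∏ b ∈ B, cutoff χ (c b * pLog p (t * ek)) (Φ b ω)) * Real.exp (-(t * W ω)) ∂μ)) (Set.Icc 0 1) t =
      iteratedDeriv α (fun t => Real.log
        (∫ ω, (∏ b ∈ B, cutoff χ (c b * pLog p (t * ek)) (Φ b ω)) * Real.exp (-(t * W ω)) ∂μ)) t :=
  iteratedDerivWithin_eq_iteratedDeriv (uniqueDiffOn_Icc zero_lt_one)
    (BIJ88PolyInteraction308.contDiffAt_log_polyInteraction χ hp μ B hΦ hc hW hK hWg hek hek1 hz α ht) ⟨ht.1.le, ht.2⟩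

/-- **Every one-sided iterated derivative of `t ↦ log z_t` at `t = 0` along `[0,1]` is the corresponding cumulant of `−Ṽ` written
through its Gaussian moments**, for a POLYNOMIALLY BOUNDED interaction:
`iteratedDerivWithin α (log z) [0,1] 0 = Σ_{c : OrderedFinpartition α} log^{(|c|)}(1)·Π_j ∫ (−W)^{|c_j|} dP`, every `α`
(centered Gaussian marginals, variances `≤ v`, `c_b ≥ c₀ > 0`, `p > 1/2`, `0 < e_k < e^{−1}`, `|W| ≤ K(1 + Σ|Φ_b|)^m`, `z_t ≠ 0` on
`(0,1]`). [cite: BalabanImbrieJaffe1988, (5.14.1) p.308] -/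
theorem iteratedDerivWithin_log_polyInteraction_zero {p : ℝ} (hp : 1 / 2 < p) (P : Measure Ω) [IsProbabilityMeasure P]
    (B : Finset ι) {Φ : ι → Ω → ℝ} (hG : ∀ b ∈ B, HasGaussianLaw (Φ b) P) (hΦ : ∀ b ∈ B, Measurable (Φ b))
    (h0 : ∀ b ∈ B, P[Φ b] = 0) {v : ℝ} (hv : 0 < v) (hvar : ∀ b ∈ B, Var[Φ b; P] ≤ v) {c : ι → ℝ} {c₀ : ℝ} (hc₀ : 0 < c₀)
    (hcb : ∀ b ∈ B, c₀ ≤ c b) {W : Ω → ℝ} (hW : Measurable W) {K : ℝ} (hK : 0 ≤ K) {m : ℕ}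
    (hWg : ∀ ω, |W ω| ≤ K * (1 + ∑ b ∈ B, |Φ b ω|) ^ m) {ek : ℝ} (hek : 0 < ek) (hek1 : ek < Real.exp (-1))
    (hz : ∀ t ∈ Set.Ioc (0 : ℝ) 1, (∫ ω, (∏ b ∈ B, cutoff χ (c b * pLog p (t * ek)) (Φ b ω)) * Real.exp (-(t * W ω)) ∂P) ≠ 0)
    (α : ℕ) :
    iteratedDerivWithin α (fun t => Real.log
        (∫ ω, (∏ b ∈ B, cutoff χ (c b * pLog p (t * ek)) (Φ b ω)) * Real.exp (-(t * W ω)) ∂P)) (Set.Icc 0 1) 0 =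
      ∑ c' : OrderedFinpartition α, iteratedDeriv c'.length Real.log 1 * ∏ j, ∫ ω, (-W ω) ^ c'.partSize j ∂P := by
  have hp0 : 0 < p := by linarith
  have hc : ∀ b ∈ B, 0 < c b := fun b hb => hc₀.trans_le (hcb b hb)
  set f : ℝ → ℝ := fun t => Real.log
    (∫ ω, (∏ b ∈ B, cutoff χ (c b * pLog p (t * ek)) (Φ b ω)) * Real.exp (-(t * W ω)) ∂P) with hfdef
  have hB : ∀ β : ℕ, ∀ t ∈ Set.Ioo (0 : ℝ) 1, iteratedDerivWithin β f (Set.Icc 0 1) t = iteratedDeriv β f t :=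
    fun β t ht => iteratedDerivWithin_Icc_log_polyInteraction χ hp0.le P B hΦ hc hW hK hWg hek hek1 hz β ⟨ht.1, ht.2.le⟩
  have hlim : ∀ β : ℕ, Tendsto (iteratedDeriv β f) (𝓝[>] (0 : ℝ))
      (𝓝 (∑ c' : OrderedFinpartition β, iteratedDeriv c'.length Real.log 1 * ∏ j, ∫ ω, (-W ω) ^ c'.partSize j ∂P)) :=
    fun β => BIJ88PolyInteractionLimits308.tendsto_iteratedDeriv_log_polyInteraction_zero χ hp P B hG hΦ h0 hv hvar hc₀ hcb hW
      hK hWg hek β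
  induction α with
  | zero =>
    -- f 0 = log z_0 = log 1 = 0, and f t → κ₀ as well as f t → log 1 = 0: κ₀ = 0
    rw [iteratedDerivWithin_zero]
    have hf0 : f 0 = 0 := by
      rw [hfdef]
      simp only
      rw [BIJ88PertTerms5141.integral_restrictedInteraction_at_zero χ hp0.ne' P B Φ c W ek, Real.log_one]
    have hz1 := BIJ88PolyInteractionLimits308.tendsto_integral_polyInteraction_one χ hp P B hG hΦ h0 hv hvar hc₀ hcb hW hK hWg hek
    have hlog : Tendsto f (𝓝[>] (0 : ℝ)) (𝓝 0) := by
      have h := ((Real.continuousAt_log one_ne_zero).tendsto.comp hz1)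
      rwa [Real.log_one] at h
    have h0' := hlim 0
    rw [iteratedDeriv_zero] at h0'
    rw [hf0]
    exact tendsto_nhds_unique hlog h0'
  | succ α ih =>
    rw [iteratedDerivWithin_succ]
    set g : ℝ → ℝ := iteratedDerivWithin α f (Set.Icc 0 1) with hgdef
    have hloc : ∀ t ∈ Set.Ioo (0 : ℝ) 1, g =ᶠ[𝓝 t] iteratedDeriv α f := fun t ht => by
      filter_upwards [isOpen_Ioo.mem_nhds ht] with s hs using hB α s hs
    have h1 : DifferentiableOn ℝ g (Set.Ioo 0 1) := fun t ht =>
      ((hloc t ht).differentiableAt_iff.mpr (differentiableAt_iteratedDeriv_of_contDiffAt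
        (BIJ88PolyInteraction308.contDiffAt_log_polyInteraction χ hp0.le P B hΦ hc hW hK hWg hek hek1 hz (α + 1)
          ⟨ht.1, ht.2.le⟩))).differentiableWithinAt
    have h2 : ContinuousWithinAt g (Set.Ioo 0 1) 0 := by
      rw [ContinuousWithinAt, nhdsWithin_Ioo_eq_nhdsGT zero_lt_one, ih]
      refine (hlim α).congr' ?_
      filter_upwards [Ioo_mem_nhdsGT zero_lt_one] with t ht using (hB α t ht).symm
    have h3 : Tendsto (fun t => deriv g t) (𝓝[>] (0 : ℝ))
        (𝓝 (∑ c' : OrderedFinpartition (α + 1), iteratedDeriv c'.length Real.log 1 * ∏ j, ∫ ω, (-W ω) ^ c'.partSize j ∂P)) := by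
      refine (hlim (α + 1)).congr' ?_
      filter_upwards [Ioo_mem_nhdsGT zero_lt_one] with t ht
      rw [(hloc t ht).deriv_eq, iteratedDeriv_succ]
    have h4 : HasDerivWithinAt g
        (∑ c' : OrderedFinpartition (α + 1), iteratedDeriv c'.length Real.log 1 * ∏ j, ∫ ω, (-W ω) ^ c'.partSize j ∂P)
        (Set.Icc 0 1) 0 :=
      (hasDerivWithinAt_Ici_of_tendsto_deriv h1 h2 (Ioo_mem_nhdsGT zero_lt_one) h3).mono Set.Icc_subset_Ici_self
    exact h4.derivWithin (uniqueDiffOn_Icc zero_lt_one 0 (Set.left_mem_Icc.mpr zero_le_one))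

/-- **Right-differentiability at `t = 0` of every order** for a polynomially bounded interaction (hypotheses as above).
[cite: BalabanImbrieJaffe1988, (5.14.1) p.308] -/
theorem hasDerivWithinAt_iteratedDerivWithin_log_poly_zero {p : ℝ} (hp : 1 / 2 < p) (P : Measure Ω) [IsProbabilityMeasure P]
    (B : Finset ι) {Φ : ι → Ω → ℝ} (hG : ∀ b ∈ B, HasGaussianLaw (Φ b) P) (hΦ : ∀ b ∈ B, Measurable (Φ b))
    (h0 : ∀ b ∈ B, P[Φ b] = 0) {v : ℝ} (hv : 0 < v) (hvar : ∀ b ∈ B, Var[Φ b; P] ≤ v) {c : ι → ℝ} {c₀ : ℝ} (hc₀ : 0 < c₀)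
    (hcb : ∀ b ∈ B, c₀ ≤ c b) {W : Ω → ℝ} (hW : Measurable W) {K : ℝ} (hK : 0 ≤ K) {m : ℕ}
    (hWg : ∀ ω, |W ω| ≤ K * (1 + ∑ b ∈ B, |Φ b ω|) ^ m) {ek : ℝ} (hek : 0 < ek) (hek1 : ek < Real.exp (-1))
    (hz : ∀ t ∈ Set.Ioc (0 : ℝ) 1, (∫ ω, (∏ b ∈ B, cutoff χ (c b * pLog p (t * ek)) (Φ b ω)) * Real.exp (-(t * W ω)) ∂P) ≠ 0)
    (α : ℕ) :
    HasDerivWithinAt (iteratedDerivWithin α (fun t => Real.log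
        (∫ ω, (∏ b ∈ B, cutoff χ (c b * pLog p (t * ek)) (Φ b ω)) * Real.exp (-(t * W ω)) ∂P)) (Set.Icc 0 1))
      (∑ c' : OrderedFinpartition (α + 1), iteratedDeriv c'.length Real.log 1 * ∏ j, ∫ ω, (-W ω) ^ c'.partSize j ∂P)
      (Set.Icc 0 1) 0 := by
  have hp0 : 0 < p := by linarith
  have hc : ∀ b ∈ B, 0 < c b := fun b hb => hc₀.trans_le (hcb b hb)
  set f : ℝ → ℝ := fun t => Real.log
    (∫ ω, (∏ b ∈ B, cutoff χ (c b * pLog p (t * ek)) (Φ b ω)) * Real.exp (-(t * W ω)) ∂P) with hfdef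
  have hB : ∀ β : ℕ, ∀ t ∈ Set.Ioo (0 : ℝ) 1, iteratedDerivWithin β f (Set.Icc 0 1) t = iteratedDeriv β f t :=
    fun β t ht => iteratedDerivWithin_Icc_log_polyInteraction χ hp0.le P B hΦ hc hW hK hWg hek hek1 hz β ⟨ht.1, ht.2.le⟩
  have hlim : ∀ β : ℕ, Tendsto (iteratedDeriv β f) (𝓝[>] (0 : ℝ))
      (𝓝 (∑ c' : OrderedFinpartition β, iteratedDeriv c'.length Real.log 1 * ∏ j, ∫ ω, (-W ω) ^ c'.partSize j ∂P)) :=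
    fun β => BIJ88PolyInteractionLimits308.tendsto_iteratedDeriv_log_polyInteraction_zero χ hp P B hG hΦ h0 hv hvar hc₀ hcb hW
      hK hWg hek β
  set g : ℝ → ℝ := iteratedDerivWithin α f (Set.Icc 0 1) with hgdef
  have hg0 : g 0 = ∑ c' : OrderedFinpartition α, iteratedDeriv c'.length Real.log 1 * ∏ j, ∫ ω, (-W ω) ^ c'.partSize j ∂P :=
    iteratedDerivWithin_log_polyInteraction_zero χ hp P B hG hΦ h0 hv hvar hc₀ hcb hW hK hWg hek hek1 hz α
  have hloc : ∀ t ∈ Set.Ioo (0 : ℝ) 1, g =ᶠ[𝓝 t] iteratedDeriv α f := fun t ht => by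
    filter_upwards [isOpen_Ioo.mem_nhds ht] with s hs using hB α s hs
  have h1 : DifferentiableOn ℝ g (Set.Ioo 0 1) := fun t ht =>
    ((hloc t ht).differentiableAt_iff.mpr (differentiableAt_iteratedDeriv_of_contDiffAt
      (BIJ88PolyInteraction308.contDiffAt_log_polyInteraction χ hp0.le P B hΦ hc hW hK hWg hek hek1 hz (α + 1)
        ⟨ht.1, ht.2.le⟩))).differentiableWithinAt
  have h2 : ContinuousWithinAt g (Set.Ioo 0 1) 0 := by
    rw [ContinuousWithinAt, nhdsWithin_Ioo_eq_nhdsGT zero_lt_one, hg0]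
    refine (hlim α).congr' ?_
    filter_upwards [Ioo_mem_nhdsGT zero_lt_one] with t ht using (hB α t ht).symm
  have h3 : Tendsto (fun t => deriv g t) (𝓝[>] (0 : ℝ))
      (𝓝 (∑ c' : OrderedFinpartition (α + 1), iteratedDeriv c'.length Real.log 1 * ∏ j, ∫ ω, (-W ω) ^ c'.partSize j ∂P)) := by
    refine (hlim (α + 1)).congr' ?_
    filter_upwards [Ioo_mem_nhdsGT zero_lt_one] with t ht
    rw [(hloc t ht).deriv_eq, iteratedDeriv_succ]
  exact (hasDerivWithinAt_Ici_of_tendsto_deriv h1 h2 (Ioo_mem_nhdsGT zero_lt_one) h3).mono Set.Icc_subset_Ici_self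

/-- Every within-`[0,1]` iterated derivative of `log z_t` is differentiable on `[0,1]` (polynomially bounded `W`).
[cite: BalabanImbrieJaffe1988, (5.14.1) p.308] -/
theorem differentiableOn_iteratedDerivWithin_log_poly {p : ℝ} (hp : 1 / 2 < p) (P : Measure Ω) [IsProbabilityMeasure P]
    (B : Finset ι) {Φ : ι → Ω → ℝ} (hG : ∀ b ∈ B, HasGaussianLaw (Φ b) P) (hΦ : ∀ b ∈ B, Measurable (Φ b))
    (h0 : ∀ b ∈ B, P[Φ b] = 0) {v : ℝ} (hv : 0 < v) (hvar : ∀ b ∈ B, Var[Φ b; P] ≤ v) {c : ι → ℝ} {c₀ : ℝ} (hc₀ : 0 < c₀)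
    (hcb : ∀ b ∈ B, c₀ ≤ c b) {W : Ω → ℝ} (hW : Measurable W) {K : ℝ} (hK : 0 ≤ K) {m : ℕ}
    (hWg : ∀ ω, |W ω| ≤ K * (1 + ∑ b ∈ B, |Φ b ω|) ^ m) {ek : ℝ} (hek : 0 < ek) (hek1 : ek < Real.exp (-1))
    (hz : ∀ t ∈ Set.Ioc (0 : ℝ) 1, (∫ ω, (∏ b ∈ B, cutoff χ (c b * pLog p (t * ek)) (Φ b ω)) * Real.exp (-(t * W ω)) ∂P) ≠ 0)
    (α : ℕ) :
    DifferentiableOn ℝ (iteratedDerivWithin α (fun t => Real.log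
        (∫ ω, (∏ b ∈ B, cutoff χ (c b * pLog p (t * ek)) (Φ b ω)) * Real.exp (-(t * W ω)) ∂P)) (Set.Icc 0 1)) (Set.Icc 0 1) := by
  have hp0 : 0 < p := by linarith
  have hc : ∀ b ∈ B, 0 < c b := fun b hb => hc₀.trans_le (hcb b hb)
  intro t ht
  rcases eq_or_lt_of_le ht.1 with h0t | hpos
  · rw [← h0t]
    exact (hasDerivWithinAt_iteratedDerivWithin_log_poly_zero χ hp P B hG hΦ h0 hv hvar hc₀ hcb hW hK hWg hek hek1 hz
      α).differentiableWithinAt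
  · have hB : ∀ s ∈ Set.Ioc (0 : ℝ) 1, iteratedDerivWithin α (fun t => Real.log
        (∫ ω, (∏ b ∈ B, cutoff χ (c b * pLog p (t * ek)) (Φ b ω)) * Real.exp (-(t * W ω)) ∂P)) (Set.Icc 0 1) s =
        iteratedDeriv α (fun t => Real.log
          (∫ ω, (∏ b ∈ B, cutoff χ (c b * pLog p (t * ek)) (Φ b ω)) * Real.exp (-(t * W ω)) ∂P)) s :=
      fun s hs => iteratedDerivWithin_Icc_log_polyInteraction χ hp0.le P B hΦ hc hW hK hWg hek hek1 hz α hs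
    have hd := differentiableAt_iteratedDeriv_of_contDiffAt
      (BIJ88PolyInteraction308.contDiffAt_log_polyInteraction χ hp0.le P B hΦ hc hW hK hWg hek hek1 hz (α + 1) ⟨hpos, ht.2⟩)
    refine hd.differentiableWithinAt.congr_of_eventuallyEq ?_ (hB t ⟨hpos, ht.2⟩)
    have hmem : Set.Ioc (0 : ℝ) 1 ∈ 𝓝[Set.Icc 0 1] t :=
      mem_nhdsWithin.mpr ⟨Set.Ioi 0, isOpen_Ioi, hpos, fun s hs => ⟨hs.1, hs.2.2⟩⟩
    filter_upwards [hmem] with s hs using hB s hs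

/-- **`t ↦ log z_t` is `Cⁿ` on the CLOSED interval `[0,1]` for every `n`, for a POLYNOMIALLY BOUNDED interaction** — the regularity
under which the row owner's `BIJ88Sect5StatementsPart4.taylor_logz` (Taylor's formula on `[0,1]`, (5.14.2)) applies verbatim; the
restrictions AND the coefficient `t` in front of the unbounded `Ṽ` are what make the family smooth up to the Gaussian point.
[cite: BalabanImbrieJaffe1988, (5.14.2) p.308] -/
theorem contDiffOn_Icc_log_polyInteraction {p : ℝ} (hp : 1 / 2 < p) (P : Measure Ω) [IsProbabilityMeasure P]
    (B : Finset ι) {Φ : ι → Ω → ℝ} (hG : ∀ b ∈ B, HasGaussianLaw (Φ b) P) (hΦ : ∀ b ∈ B, Measurable (Φ b))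
    (h0 : ∀ b ∈ B, P[Φ b] = 0) {v : ℝ} (hv : 0 < v) (hvar : ∀ b ∈ B, Var[Φ b; P] ≤ v) {c : ι → ℝ} {c₀ : ℝ} (hc₀ : 0 < c₀)
    (hcb : ∀ b ∈ B, c₀ ≤ c b) {W : Ω → ℝ} (hW : Measurable W) {K : ℝ} (hK : 0 ≤ K) {m : ℕ}
    (hWg : ∀ ω, |W ω| ≤ K * (1 + ∑ b ∈ B, |Φ b ω|) ^ m) {ek : ℝ} (hek : 0 < ek) (hek1 : ek < Real.exp (-1))
    (hz : ∀ t ∈ Set.Ioc (0 : ℝ) 1, (∫ ω, (∏ b ∈ B, cutoff χ (c b * pLog p (t * ek)) (Φ b ω)) * Real.exp (-(t * W ω)) ∂P) ≠ 0)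
    (n : ℕ) :
    ContDiffOn ℝ n (fun t => Real.log
        (∫ ω, (∏ b ∈ B, cutoff χ (c b * pLog p (t * ek)) (Φ b ω)) * Real.exp (-(t * W ω)) ∂P)) (Set.Icc 0 1) := by
  set f : ℝ → ℝ := fun t => Real.log
    (∫ ω, (∏ b ∈ B, cutoff χ (c b * pLog p (t * ek)) (Φ b ω)) * Real.exp (-(t * W ω)) ∂P) with hfdef
  have hdiff : ∀ m' : ℕ, DifferentiableOn ℝ (iteratedDerivWithin m' f (Set.Icc 0 1)) (Set.Icc 0 1) := fun m' =>
    differentiableOn_iteratedDerivWithin_log_poly χ hp P B hG hΦ h0 hv hvar hc₀ hcb hW hK hWg hek hek1 hz m'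
  have key : ∀ n m' : ℕ, ContDiffOn ℝ n (iteratedDerivWithin m' f (Set.Icc 0 1)) (Set.Icc 0 1) := by
    intro n
    induction n with
    | zero => exact fun m' => contDiffOn_zero.mpr (hdiff m').continuousOn
    | succ n ih =>
      intro m'
      rw [Nat.cast_succ, contDiffOn_succ_iff_derivWithin (uniqueDiffOn_Icc zero_lt_one)]
      refine ⟨hdiff m', fun h => absurd h (by exact_mod_cast WithTop.natCast_ne_top n), ?_⟩
      rw [← iteratedDerivWithin_succ]
      exact ih (m' + 1)
  have h := key n 0
  rwa [iteratedDerivWithin_zero] at h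

end OneSided

/-! ## §2 (5.14.1)–(5.14.2) as typed, for polynomially bounded interactions -/

section Typed

variable (χ : CutoffProfile) {ι Ω : Type*} [MeasurableSpace Ω]

/-- **Print's `𝒫_{k+1}` AS TYPED (`BIJ88Sect5StatementsPart4.pertP`) for a polynomially bounded interaction is the cumulant sum**
`pertP (log z) n̄ = Σ_{α<n̄} −(1/(α+1)!)·κ_{α+1}(−W)`, `κ` the Gaussian cumulants of `−Ṽ` in moment form.
[cite: BalabanImbrieJaffe1988, (5.14.1) p.308] -/
theorem pertP_polyInteraction {p : ℝ} (hp : 1 / 2 < p) (P : Measure Ω) [IsProbabilityMeasure P]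
    (B : Finset ι) {Φ : ι → Ω → ℝ} (hG : ∀ b ∈ B, HasGaussianLaw (Φ b) P) (hΦ : ∀ b ∈ B, Measurable (Φ b))
    (h0 : ∀ b ∈ B, P[Φ b] = 0) {v : ℝ} (hv : 0 < v) (hvar : ∀ b ∈ B, Var[Φ b; P] ≤ v) {c : ι → ℝ} {c₀ : ℝ} (hc₀ : 0 < c₀)
    (hcb : ∀ b ∈ B, c₀ ≤ c b) {W : Ω → ℝ} (hW : Measurable W) {K : ℝ} (hK : 0 ≤ K) {m : ℕ}
    (hWg : ∀ ω, |W ω| ≤ K * (1 + ∑ b ∈ B, |Φ b ω|) ^ m) {ek : ℝ} (hek : 0 < ek) (hek1 : ek < Real.exp (-1))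
    (hz : ∀ t ∈ Set.Ioc (0 : ℝ) 1, (∫ ω, (∏ b ∈ B, cutoff χ (c b * pLog p (t * ek)) (Φ b ω)) * Real.exp (-(t * W ω)) ∂P) ≠ 0)
    (nbar : ℕ) :
    pertP (fun t => Real.log (∫ ω, (∏ b ∈ B, cutoff χ (c b * pLog p (t * ek)) (Φ b ω)) * Real.exp (-(t * W ω)) ∂P)) nbar =
      ∑ α ∈ Finset.range nbar, -((1 : ℝ) / (α + 1).factorial) *
        ∑ c' : OrderedFinpartition (α + 1), iteratedDeriv c'.length Real.log 1 * ∏ j, ∫ ω, (-W ω) ^ c'.partSize j ∂P := by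
  rw [pertP, Set.uIcc_of_le zero_le_one]
  refine Finset.sum_congr rfl fun α _ => ?_
  rw [iteratedDerivWithin_log_polyInteraction_zero χ hp P B hG hΦ h0 hv hvar hc₀ hcb hW hK hWg hek hek1 hz (α + 1)]

/-- **The row owner's Taylor formula (5.14.2) `taylor_logz` applied verbatim to the polynomial-`W` family** (`log z_0 = 0`):
`log z₁ = −pertP (log z) n̄ + ∫₀¹ ((1−t)^{n̄}/n̄!)·iteratedDerivWithin (n̄+1) (log z) [0,1] t dt`. [cite: BalabanImbrieJaffe1988, (5.14.2) p.308] -/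
theorem taylor_logz_polyInteraction {p : ℝ} (hp : 1 / 2 < p) (P : Measure Ω) [IsProbabilityMeasure P]
    (B : Finset ι) {Φ : ι → Ω → ℝ} (hG : ∀ b ∈ B, HasGaussianLaw (Φ b) P) (hΦ : ∀ b ∈ B, Measurable (Φ b))
    (h0 : ∀ b ∈ B, P[Φ b] = 0) {v : ℝ} (hv : 0 < v) (hvar : ∀ b ∈ B, Var[Φ b; P] ≤ v) {c : ι → ℝ} {c₀ : ℝ} (hc₀ : 0 < c₀)
    (hcb : ∀ b ∈ B, c₀ ≤ c b) {W : Ω → ℝ} (hW : Measurable W) {K : ℝ} (hK : 0 ≤ K) {m : ℕ}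
    (hWg : ∀ ω, |W ω| ≤ K * (1 + ∑ b ∈ B, |Φ b ω|) ^ m) {ek : ℝ} (hek : 0 < ek) (hek1 : ek < Real.exp (-1))
    (hz : ∀ t ∈ Set.Ioc (0 : ℝ) 1, (∫ ω, (∏ b ∈ B, cutoff χ (c b * pLog p (t * ek)) (Φ b ω)) * Real.exp (-(t * W ω)) ∂P) ≠ 0)
    (nbar : ℕ) :
    Real.log (∫ ω, (∏ b ∈ B, cutoff χ (c b * pLog p (1 * ek)) (Φ b ω)) * Real.exp (-(1 * W ω)) ∂P) =
      -pertP (fun t => Real.log (∫ ω, (∏ b ∈ B, cutoff χ (c b * pLog p (t * ek)) (Φ b ω)) * Real.exp (-(t * W ω)) ∂P)) nbar +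
        ∫ t in (0 : ℝ)..1, ((1 - t) ^ nbar / nbar.factorial) * iteratedDerivWithin (nbar + 1) (fun t => Real.log
          (∫ ω, (∏ b ∈ B, cutoff χ (c b * pLog p (t * ek)) (Φ b ω)) * Real.exp (-(t * W ω)) ∂P)) (Set.uIcc 0 1) t := by
  have hcd := contDiffOn_Icc_log_polyInteraction χ hp P B hG hΦ h0 hv hvar hc₀ hcb hW hK hWg hek hek1 hz (nbar + 1)
  rw [← Set.uIcc_of_le zero_le_one] at hcd
  have h := BIJ88Sect5StatementsPart4.taylor_logz (nbar := nbar) hcd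
  rw [BIJ88PertTerms5141.integral_restrictedInteraction_at_zero χ (by linarith : p ≠ 0), Real.log_one, zero_sub] at h
  exact h

/-- **(5.14.1)–(5.14.2) AS TYPED with NO standing hypothesis, for a POLYNOMIALLY BOUNDED interaction**: non-negative profile
`χ(1,·) ≥ 0`, CENTERED JOINTLY GAUSSIAN fields (Mathlib `HasGaussianLaw` of `ω ↦ (Φ_b ω)_{b∈Λ}`), thresholds `c_b ≥ c₀ > 0`, `p > 1/2`,
`0 < e_k < e^{−1}`, measurable `W` with `|W| ≤ K(1 + Σ_{b∈Λ}|Φ_b|)^m`, `K ≥ 0`, every `n̄`: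
`−log z₁ = pertP (log z) n̄ − ∫₀¹ ((1−t)^{n̄}/n̄!)·iteratedDerivWithin (n̄+1) (log z) [0,1] t dt` with `log z ∈ C^∞([0,1])` and
`pertP (log z) n̄` the cumulant sum of `−Ṽ` — print's bracketed p. 309 remark made a theorem: the interaction is NOT replaced by a
supremum. [cite: BalabanImbrieJaffe1988, (5.14.2) p.308] -/
theorem effectiveAction_polyInteraction (hχ : ∀ x, 0 ≤ χ.χ₁ x) {p : ℝ} (hp : 1 / 2 < p) (P : Measure Ω) [IsProbabilityMeasure P]
    (B : Finset ι) {Φ : ι → Ω → ℝ} (hJ : HasGaussianLaw (fun ω (b : B) => Φ b ω) P) (hΦ : ∀ b ∈ B, Measurable (Φ b))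
    (h0 : ∀ b ∈ B, P[Φ b] = 0) {c : ι → ℝ} {c₀ : ℝ} (hc₀ : 0 < c₀) (hcb : ∀ b ∈ B, c₀ ≤ c b) {W : Ω → ℝ} (hW : Measurable W)
    {K : ℝ} (hK : 0 ≤ K) {m : ℕ} (hWg : ∀ ω, |W ω| ≤ K * (1 + ∑ b ∈ B, |Φ b ω|) ^ m) {ek : ℝ} (hek : 0 < ek)
    (hek1 : ek < Real.exp (-1)) (nbar : ℕ) :
    -Real.log (∫ ω, (∏ b ∈ B, cutoff χ (c b * pLog p (1 * ek)) (Φ b ω)) * Real.exp (-(1 * W ω)) ∂P) =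
      pertP (fun t => Real.log (∫ ω, (∏ b ∈ B, cutoff χ (c b * pLog p (t * ek)) (Φ b ω)) * Real.exp (-(t * W ω)) ∂P)) nbar -
        ∫ t in (0 : ℝ)..1, ((1 - t) ^ nbar / nbar.factorial) * iteratedDerivWithin (nbar + 1) (fun t => Real.log
          (∫ ω, (∏ b ∈ B, cutoff χ (c b * pLog p (t * ek)) (Φ b ω)) * Real.exp (-(t * W ω)) ∂P)) (Set.uIcc 0 1) t ∧
    pertP (fun t => Real.log (∫ ω, (∏ b ∈ B, cutoff χ (c b * pLog p (t * ek)) (Φ b ω)) * Real.exp (-(t * W ω)) ∂P)) nbar =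
      ∑ α ∈ Finset.range nbar, -((1 : ℝ) / (α + 1).factorial) *
        ∑ c' : OrderedFinpartition (α + 1), iteratedDeriv c'.length Real.log 1 * ∏ j, ∫ ω, (-W ω) ^ c'.partSize j ∂P := by
  obtain ⟨hv, hvar⟩ := BIJ88EffectiveAction308.variance_le_one_add_sum P B Φ
  have hG := BIJ88ZtPositivity308.hasGaussianLaw_of_joint P B hJ
  have hp0 : (0 : ℝ) ≤ p := by linarith
  have hz := BIJ88PolyInteraction308.integral_polyInteraction_ne_zero_Ioc χ hχ hp0 P B hJ hΦ h0 hc₀ hcb hW hK hWg hek hek1.le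
  refine ⟨?_, pertP_polyInteraction χ hp P B hG hΦ h0 hv hvar hc₀ hcb hW hK hWg hek hek1 hz nbar⟩
  have h := taylor_logz_polyInteraction χ hp P B hG hΦ h0 hv hvar hc₀ hcb hW hK hWg hek hek1 hz nbar
  linarith

/-- `log z ∈ Cⁿ([0,1])` for every `n`, no standing hypothesis (non-negative profile, centered jointly Gaussian fields, polynomially bounded
interaction). [cite: BalabanImbrieJaffe1988, (5.14.2) p.308] -/
theorem contDiffOn_Icc_log_polyInteraction' (hχ : ∀ x, 0 ≤ χ.χ₁ x) {p : ℝ} (hp : 1 / 2 < p) (P : Measure Ω)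
    [IsProbabilityMeasure P] (B : Finset ι) {Φ : ι → Ω → ℝ} (hJ : HasGaussianLaw (fun ω (b : B) => Φ b ω) P)
    (hΦ : ∀ b ∈ B, Measurable (Φ b)) (h0 : ∀ b ∈ B, P[Φ b] = 0) {c : ι → ℝ} {c₀ : ℝ} (hc₀ : 0 < c₀) (hcb : ∀ b ∈ B, c₀ ≤ c b)
    {W : Ω → ℝ} (hW : Measurable W) {K : ℝ} (hK : 0 ≤ K) {m : ℕ} (hWg : ∀ ω, |W ω| ≤ K * (1 + ∑ b ∈ B, |Φ b ω|) ^ m)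
    {ek : ℝ} (hek : 0 < ek) (hek1 : ek < Real.exp (-1)) (n : ℕ) :
    ContDiffOn ℝ n (fun t => Real.log
        (∫ ω, (∏ b ∈ B, cutoff χ (c b * pLog p (t * ek)) (Φ b ω)) * Real.exp (-(t * W ω)) ∂P)) (Set.Icc 0 1) := by
  obtain ⟨hv, hvar⟩ := BIJ88EffectiveAction308.variance_le_one_add_sum P B Φ
  have hp0 : (0 : ℝ) ≤ p := by linarith
  exact contDiffOn_Icc_log_polyInteraction χ hp P B (BIJ88ZtPositivity308.hasGaussianLaw_of_joint P B hJ) hΦ h0 hv hvar hc₀ hcb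
    hW hK hWg hek hek1
    (BIJ88PolyInteraction308.integral_polyInteraction_ne_zero_Ioc χ hχ hp0 P B hJ hΦ h0 hc₀ hcb hW hK hWg hek hek1.le) n

/-- **The (5.14.2) remainder density is continuous on the CLOSED interval `[0,1]`, hence integrable** — `t ↦ ((1−t)^{n̄}/n̄!)·(d/dt)^{n̄+1}log z_t`
with one-sided derivatives along `[0,1]`; polynomially bounded interaction, non-negative profile, centered jointly Gaussian fields, no standing
hypothesis (the `hint` of `BIJ88PerturbativeRemainder308` in its strongest form). [cite: BalabanImbrieJaffe1988, (5.14.2) p.308] -/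
theorem continuousOn_remainderDensity_poly (hχ : ∀ x, 0 ≤ χ.χ₁ x) {p : ℝ} (hp : 1 / 2 < p) (P : Measure Ω)
    [IsProbabilityMeasure P] (B : Finset ι) {Φ : ι → Ω → ℝ} (hJ : HasGaussianLaw (fun ω (b : B) => Φ b ω) P)
    (hΦ : ∀ b ∈ B, Measurable (Φ b)) (h0 : ∀ b ∈ B, P[Φ b] = 0) {c : ι → ℝ} {c₀ : ℝ} (hc₀ : 0 < c₀) (hcb : ∀ b ∈ B, c₀ ≤ c b)
    {W : Ω → ℝ} (hW : Measurable W) {K : ℝ} (hK : 0 ≤ K) {m : ℕ} (hWg : ∀ ω, |W ω| ≤ K * (1 + ∑ b ∈ B, |Φ b ω|) ^ m)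
    {ek : ℝ} (hek : 0 < ek) (hek1 : ek < Real.exp (-1)) (nbar : ℕ) :
    ContinuousOn (fun t => ((1 - t) ^ nbar / nbar.factorial) * iteratedDerivWithin (nbar + 1) (fun t => Real.log
        (∫ ω, (∏ b ∈ B, cutoff χ (c b * pLog p (t * ek)) (Φ b ω)) * Real.exp (-(t * W ω)) ∂P)) (Set.Icc 0 1) t) (Set.Icc 0 1) := by
  have h := (contDiffOn_Icc_log_polyInteraction' χ hχ hp P B hJ hΦ h0 hc₀ hcb hW hK hWg hek hek1
    (nbar + 1)).continuousOn_iteratedDerivWithin le_rfl (uniqueDiffOn_Icc zero_lt_one)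
  exact (((continuous_const.sub continuous_id).pow nbar).div_const _).continuousOn.mul h

/-- Integrability on `[0,1]` of the (5.14.2) remainder density for a polynomially bounded interaction, no standing hypothesis.
[cite: BalabanImbrieJaffe1988, (5.14.2) p.308] -/
theorem integrableOn_remainderDensity_poly (hχ : ∀ x, 0 ≤ χ.χ₁ x) {p : ℝ} (hp : 1 / 2 < p) (P : Measure Ω)
    [IsProbabilityMeasure P] (B : Finset ι) {Φ : ι → Ω → ℝ} (hJ : HasGaussianLaw (fun ω (b : B) => Φ b ω) P)
    (hΦ : ∀ b ∈ B, Measurable (Φ b)) (h0 : ∀ b ∈ B, P[Φ b] = 0) {c : ι → ℝ} {c₀ : ℝ} (hc₀ : 0 < c₀) (hcb : ∀ b ∈ B, c₀ ≤ c b)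
    {W : Ω → ℝ} (hW : Measurable W) {K : ℝ} (hK : 0 ≤ K) {m : ℕ} (hWg : ∀ ω, |W ω| ≤ K * (1 + ∑ b ∈ B, |Φ b ω|) ^ m)
    {ek : ℝ} (hek : 0 < ek) (hek1 : ek < Real.exp (-1)) (nbar : ℕ) :
    IntegrableOn (fun t => ((1 - t) ^ nbar / nbar.factorial) * iteratedDerivWithin (nbar + 1) (fun t => Real.log
        (∫ ω, (∏ b ∈ B, cutoff χ (c b * pLog p (t * ek)) (Φ b ω)) * Real.exp (-(t * W ω)) ∂P)) (Set.Icc 0 1) t) (Set.Icc 0 1) :=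
  (continuousOn_remainderDensity_poly χ hχ hp P B hJ hΦ h0 hc₀ hcb hW hK hWg hek hek1 nbar).integrableOn_Icc

/-- (v1.1) **The row owner's `logz_split` — (5.14.2) in print's `log z₁ = log z₀ − 𝒫̃_{k+1} − ℛ_k` shape under the T9 identification
`⟨d/dt; …; d/dt⟩_t = (n̄+1)·(d/dt)^{n̄+1} log z_t` (recorded, not adjudicated, in `BIJ88Sect5StatementsPart4.remR`) — instantiated by the
polynomial-`W` family with NO standing hypothesis** (`log z₀ = 0`): `log z₁ = 0 − pertP (log z) n̄ − remR ((n̄+1)·∂ₜ^{n̄+1} log z) n̄`.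
[cite: BalabanImbrieJaffe1988, (5.14.2) p.308] -/
theorem logz_split_polyInteraction (hχ : ∀ x, 0 ≤ χ.χ₁ x) {p : ℝ} (hp : 1 / 2 < p) (P : Measure Ω) [IsProbabilityMeasure P]
    (B : Finset ι) {Φ : ι → Ω → ℝ} (hJ : HasGaussianLaw (fun ω (b : B) => Φ b ω) P) (hΦ : ∀ b ∈ B, Measurable (Φ b))
    (h0 : ∀ b ∈ B, P[Φ b] = 0) {c : ι → ℝ} {c₀ : ℝ} (hc₀ : 0 < c₀) (hcb : ∀ b ∈ B, c₀ ≤ c b) {W : Ω → ℝ} (hW : Measurable W)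
    {K : ℝ} (hK : 0 ≤ K) {m : ℕ} (hWg : ∀ ω, |W ω| ≤ K * (1 + ∑ b ∈ B, |Φ b ω|) ^ m) {ek : ℝ} (hek : 0 < ek)
    (hek1 : ek < Real.exp (-1)) (nbar : ℕ) :
    Real.log (∫ ω, (∏ b ∈ B, cutoff χ (c b * pLog p (1 * ek)) (Φ b ω)) * Real.exp (-(1 * W ω)) ∂P) =
      0 - pertP (fun t => Real.log (∫ ω, (∏ b ∈ B, cutoff χ (c b * pLog p (t * ek)) (Φ b ω)) * Real.exp (-(t * W ω)) ∂P)) nbar -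
        BIJ88Sect5StatementsPart4.remR (fun t => ((nbar : ℝ) + 1) * iteratedDerivWithin (nbar + 1) (fun t => Real.log
          (∫ ω, (∏ b ∈ B, cutoff χ (c b * pLog p (t * ek)) (Φ b ω)) * Real.exp (-(t * W ω)) ∂P)) (Set.uIcc 0 1) t) nbar := by
  have hcd := contDiffOn_Icc_log_polyInteraction' χ hχ hp P B hJ hΦ h0 hc₀ hcb hW hK hWg hek hek1 (nbar + 1)
  rw [← Set.uIcc_of_le zero_le_one] at hcd
  have h := BIJ88Sect5StatementsPart4.logz_split (nbar := nbar) hcd (fun _ => rfl)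
  rw [BIJ88PertTerms5141.integral_restrictedInteraction_at_zero χ (by linarith : p ≠ 0), Real.log_one] at h
  exact h

end Typed

end Literature.MathematicalPhysics.QuantumFieldTheory.BalabanImbrieJaffe1984to88.BIJ88PolyInteractionAction308
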